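import Summits.Ventures.CertifiedManyBodySolver.Observables.PolarisedClassExclusionObjectE
import Summits.Ventures.CertifiedManyBodySolver.Certificates.HubbardSquare_n7o8_boxface_tpm1o4_UxN_pieces_r448_r445_r257_r472_r488
import Summits.Ventures.CertifiedManyBodySolver.Certificates.HubbardSquare_n1_upper_pb2_U10_row471
import HarnessLib

/-!
# Ventures/CertifiedManyBodySolver — Observables/PolarisedClassExclusionLaU10.lean

HONEST FRAMING: first certified bounds; not a superconductivity verdict; every number certified or labelled float.
A competing-order EXCLUSION removes a named class of candidate ground states; it never says which order is present;
no phase sentence follows.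

Cell `hubbard-tc` (MO-S3, D-0096), seat `hubbard-tc-mod-3` (G3), `prover-hubbard-tc-mod-3-g4-0`. The SATURATED-FERROMAGNET word of
`PolarisedClassExclusionObjectE.lean` for La₁.₉₃Sr₀.₀₇CuO₄ (VSET M14; S1 box of record, OBJECT E: `U/t_eff ∈ [7.9, 14.7]`,
`t′/t_eff ∈ [−0.30, −0.20]`, `n ∈ [0.91, 0.95]`) EXTENDED UPWARD IN `U`: `laE_x007_lt_polarised_of` there stops at `U = 8` (a sliver of the
box); here

  `energyDensityTT' 1 t′ U n < ½ · energyDensityTT' 1 t′ 0 (2n)`   for every `0 ≤ U ≤ 10`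

(`laE_x007_lt_polarised_U10_of`, cond. #445 ∧ #257 (both edges) ∧ #471) — i.e. on `U/t_eff ∈ [7.9, 10]` of the box the ground state is not a
fully spin-polarised state (the one-species bathtub floor `½·e(1, t′, 0, 2n)` of every saturated-FM state lies strictly above a certified
GS-energy cap; Tasaki 1998 Thm 6.1 logic). The cap at `U₂ = 10` is the DENSITY CHORD between (i) the `n = 7/8` anchor carried from
`U = 8` to `U = 10` by the docc-TANGENT of the box crew (`BoxWordTpm1o4UxN.n78_upper_Uge8`: CERTIFIED #445 cap + the CERTIFIED #257 docc
ceiling `D_hi ≈ 0.0945` as the Hellmann–Feynman slope ⇒ `e(1, −1/4, 10, 7/8) ≤ −0.4976359739`) and then in `t′` by the decimal kinematic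
law `1.6212·|t′ + 1/4|`, and (ii) the CERTIFIED #471 half-filling cap at `U = 10` (`−0.4241559431`, every `t′` by evenness + concavity);
the bilinear `(1 − n)·t′` term of the chord is bounded by its McCORMICK majorant (exact on the binding edges `n = n₁`, `t′ = ∓1/4`),
so every leaf is one linear inequality (`linarith`). Floors = the high-density tangent rows at `2n₀ = 93/50`
(`HubbardFermiSeaTangentRowsHigh`), read between columns by concavity. Smallest exact margins `+0.0227` (`t′ ≤ −1/4`) and `+0.0363`
(`t′ ≥ −1/4`) (seat designer `hubbard-tc-mod-3/g4-replay/fm_design.py`). At `U₂ = 10.5` the test fails (`−0.03`): `U ≤ 10` is the reach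
of these rows; the seat's cert-num engine printed `U ≤ 10.1`.
WHAT THIS IS NOT: a statement about unsaturated ferromagnetism, stripes, d-wave order or T_c; an extension for x = ⅛ / Na-CCOC (their
`U ≤ 8` words do not extend with these rows: margins `−0.03` / worse at `U₂ = 9`); tight; a phase word.

References: E. H. Lieb, M. Loss, Duke Math. J. 71 (1993) 337, §8 Thm 8.2 [LiebLoss1993]; H. Tasaki, J. Phys.: Condens. Matter 10 (1998)
4353, §2 Def. 2.1, §6 Thm. 6.1 [Tasaki1998]; T. Koma, H. Tasaki, J. Stat. Phys. 76 (1994) 745, §1 [KomaTasaki1994]; R. B. Israel,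
Convexity in the Theory of Lattice Gases (1979), Thm I.3.4 [Israel1979]; D. Ruelle, Statistical Mechanics (1969) §3.3 [Ruelle1969].
-/

noncomputable section

namespace Summit.Ventures.CertifiedManyBodySolver.Observables

open Literature.MathematicalPhysics.QuantumLattice
open Literature.MathematicalPhysics.QuantumLattice.ThermodynamicLimit
open Summit.Ventures.CertifiedManyBodySolver.Certificates
open Matrix HubbardWave0 Literature.Probability.LatticeModels Filter Topology
open scoped ComplexOrder BigOperators


/-! ### §1 Devices at `U₂ = 10` -/

/-- **The `n = 7/8`, `t′ = −1/4` cap at `U = 10`** as a decimal: `e(1, −1/4, 10, 7/8) ≤ −0.4976359739` — the docc-tangent of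
`BoxWordTpm1o4UxN.n78_upper_Uge8` (CERTIFIED #445 cap at `U = 8` plus `(10 − 8)·D_hi`, `D_hi` = CERTIFIED #257 docc ceiling; concavity of
`U ↦ e` with the Hellmann–Feynman supergradient). [cite: KomaTasaki1994, §1] -/
theorem polarU_cap78_tpm1o4_U10 (h445 : cert_dbt329pair_allk) (h257lo : cert_r257_lro_M3U8tpm1o4_w2_b4_kry1_kry2c3_hop2_Dlo)
    (h257up : cert_r257_lro_M3U8tpm1o4_w2_b4_kry1_kry2c3_hop2_Dup) :
    energyDensityTT' 1 (-1 / 4) 10 (7 / 8) ≤ -0.4976359739 := by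
  have h := BoxWordTpm1o4UxN.n78_upper_Uge8 h445 h257lo h257up (U := 10) (by norm_num)
  refine h.trans ?_
  norm_num

/-- **The half-filling cap at `U = 10`, every `t′`**: `e(1, s, 10, 1) ≤ −0.4241559431` (CERTIFIED #471 at `t′ = 0`; `t′`-even + concave at
half filling). [cite: Israel1979, Thm. I.3.4] -/
theorem polarU_halfFilling_cap10 (h471 : cert_r471_pb2_tl_upper_n1_U10) (s : ℝ) :
    energyDensityTT' 1 s 10 1 ≤ -0.4241559431 := by
  have h := m2_U10_upper_r471_print h471
  have h0 : energyDensityTT' 1 0 10 1 ≤ -0.4241559431 := by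
    rw [energyDensityTT'_zero]
    refine h.trans ?_
    push_cast
    norm_num
  exact (energyDensityTT'_one_le_tPrime_zero 1 s (by norm_num : (0 : ℝ) ≤ 10)).trans h0

/-- **High-band chord cap, near side of the `−1/4` anchor, McCormick form** (`U ≥ 0`, `−1/4 ≤ a ≤ s`, `n₁ ≤ n`, `7/8 < n < 1`):
caps `e(1, −1/4, U, 7/8) ≤ M` and `e(1, s, U, 1) ≤ C` give
`e(1, s, U, n) ≤ 8[(1 − n)(M + 1.6212/4) + (n − 7/8)C] + 8·1.6212·[(1 − n₁)(s − a) + (1 − n)a]` — the anchor transported to `s`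
(`M + 1.6212(s + 1/4)`), the density chord between `7/8` and `1`, and the bilinear term `(1 − n)·s ≤ (1 − n₁)(s − a) + (1 − n)a`
(`(s − a)(n − n₁) ≥ 0`; exact at `n = n₁` and at `s = a`). [cite: Ruelle1969, §3.3] [cite: Israel1979, Thm. I.3.4] -/
theorem polarU_highBand_shallow {s n n₁ a M C U : ℝ} (hU : 0 ≤ U) (hM : energyDensityTT' 1 (-1 / 4) U (7 / 8) ≤ M)
    (hC : energyDensityTT' 1 s U 1 ≤ C) (ha : -1 / 4 ≤ a) (has : a ≤ s) (hn₁ : n₁ ≤ n) (h78 : 7 / 8 < n) (hn1 : n < 1) :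
    energyDensityTT' 1 s U n ≤
      8 * ((1 - n) * (M + 1.6212 / 4) + (n - 7 / 8) * C) + 8 * 1.6212 * ((1 - n₁) * (s - a) + (1 - n) * a) := by
  have hR : energyDensityTT' 1 s U (7 / 8) ≤ M + 1.6212 * (s + 1 / 4) := by
    have h := energyDensityTT'_tPrime_transport_ge_decimal 1 hU (by norm_num : (0 : ℝ) ≤ 7 / 8)
      (by norm_num : (7 / 8 : ℝ) < 2) s (-1 / 4)
    rw [show (-1 / 4 : ℝ) - s = -(s + 1 / 4) by ring, abs_neg, abs_of_nonneg (by linarith : 0 ≤ s + 1 / 4)] at h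
    linarith
  have hd := energyDensityTT'_le_density_chord 1 s hU (n₁ := 7 / 8) (n := n) (n₂ := 1)
    (by norm_num) h78 hn1 (by norm_num) hR hC
  have e1 : ((1 - n) * (M + 1.6212 * (s + 1 / 4)) + (n - 7 / 8) * C) / (1 - 7 / 8) =
      8 * ((1 - n) * (M + 1.6212 / 4) + (n - 7 / 8) * C) + 8 * 1.6212 * ((1 - n) * s) := by ring
  rw [e1] at hd
  have hmc : (1 - n) * s ≤ (1 - n₁) * (s - a) + (1 - n) * a := by
    nlinarith [mul_nonneg (sub_nonneg.2 has) (sub_nonneg.2 hn₁)]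
  have h8 : 8 * 1.6212 * ((1 - n) * s) ≤ 8 * 1.6212 * ((1 - n₁) * (s - a) + (1 - n) * a) :=
    mul_le_mul_of_nonneg_left hmc (by norm_num)
  linarith

/-- **High-band chord cap, far side of the `−1/4` anchor, McCormick form** (`U ≥ 0`, `s ≤ b ≤ −1/4`, `n₁ ≤ n`, `7/8 < n < 1`):
caps `e(1, −1/4, U, 7/8) ≤ M` and `e(1, s, U, 1) ≤ C` give
`e(1, s, U, n) ≤ 8[(1 − n)(M − 1.6212/4) + (n − 7/8)C] + 8·1.6212·[(1 − n₁)(b − s) − (1 − n)b]` — the anchor transported to `s`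
(`M + 1.6212(−1/4 − s)`), the density chord, and `(1 − n)(−s) ≤ (1 − n₁)(b − s) − (1 − n)b` (`(b − s)(n − n₁) ≥ 0`).
[cite: Ruelle1969, §3.3] [cite: Israel1979, Thm. I.3.4] -/
theorem polarU_highBand_deep {s n n₁ b M C U : ℝ} (hU : 0 ≤ U) (hM : energyDensityTT' 1 (-1 / 4) U (7 / 8) ≤ M)
    (hC : energyDensityTT' 1 s U 1 ≤ C) (hb : b ≤ -1 / 4) (hsb : s ≤ b) (hn₁ : n₁ ≤ n) (h78 : 7 / 8 < n) (hn1 : n < 1) :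
    energyDensityTT' 1 s U n ≤
      8 * ((1 - n) * (M - 1.6212 / 4) + (n - 7 / 8) * C) + 8 * 1.6212 * ((1 - n₁) * (b - s) - (1 - n) * b) := by
  have hR : energyDensityTT' 1 s U (7 / 8) ≤ M + 1.6212 * (-1 / 4 - s) := by
    have h := energyDensityTT'_tPrime_transport_ge_decimal 1 hU (by norm_num : (0 : ℝ) ≤ 7 / 8)
      (by norm_num : (7 / 8 : ℝ) < 2) s (-1 / 4)
    rw [abs_of_nonneg (by linarith : 0 ≤ (-1 / 4 : ℝ) - s)] at h
    linarith
  have hd := energyDensityTT'_le_density_chord 1 s hU (n₁ := 7 / 8) (n := n) (n₂ := 1)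
    (by norm_num) h78 hn1 (by norm_num) hR hC
  have e1 : ((1 - n) * (M + 1.6212 * (-1 / 4 - s)) + (n - 7 / 8) * C) / (1 - 7 / 8) =
      8 * ((1 - n) * (M - 1.6212 / 4) + (n - 7 / 8) * C) + 8 * 1.6212 * ((1 - n) * -s) := by ring
  rw [e1] at hd
  have hmc : (1 - n) * -s ≤ (1 - n₁) * (b - s) - (1 - n) * b := by
    nlinarith [mul_nonneg (sub_nonneg.2 hsb) (sub_nonneg.2 hn₁)]
  have h8 : 8 * 1.6212 * ((1 - n) * -s) ≤ 8 * 1.6212 * ((1 - n₁) * (b - s) - (1 - n) * b) :=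
    mul_le_mul_of_nonneg_left hmc (by norm_num)
  linarith


/-! ### §2 The word -/

/-- **La₁.₉₃Sr₀.₀₇CuO₄ (VSET M14), OBJECT E `n ∈ [0.91, 0.95]`, `t′ ∈ [−3/10, −1/5]`: the SATURATED-FM class is excluded for EVERY
`0 ≤ U ≤ 10`** (box `U/t_eff ∈ [7.9, 14.7]`; extends `laE_x007_lt_polarised_of`, `U ≤ 8`). Assume the claim nodes of CERTIFIED #445,
#257 (both edges) and #471. Cap at `U₂ = 10` = the McCormick high-band chords `polarU_highBand_deep` (`t′ ≤ −1/4`) /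
`polarU_highBand_shallow` (`t′ ≥ −1/4`) on `polarU_cap78_tpm1o4_U10` ∧ `polarU_halfFilling_cap10`, monotone in `U` below `10`; floor = tangent
rows at `2n₀ = 93/50` on the columns `−3/10, −1/4, −1/5`; smallest linear margins `+0.0227` / `+0.0363`.
[cite: LiebLoss1993, §8, Theorem 8.2] [cite: Tasaki1998, §2 Def. 2.1, §6 Thm. 6.1] [cite: Israel1979, Thm. I.3.4] -/
theorem laE_x007_lt_polarised_U10_of (h445 : cert_dbt329pair_allk)
    (h257lo : cert_r257_lro_M3U8tpm1o4_w2_b4_kry1_kry2c3_hop2_Dlo)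
    (h257up : cert_r257_lro_M3U8tpm1o4_w2_b4_kry1_kry2c3_hop2_Dup) (h471 : cert_r471_pb2_tl_upper_n1_U10)
    {t' U n : ℝ} (ht1 : -3 / 10 ≤ t') (ht2 : t' ≤ -1 / 5) (hU0 : 0 ≤ U) (hU : U ≤ 10)
    (hn1 : 91 / 100 ≤ n) (hn2 : n ≤ 19 / 20) :
    energyDensityTT' 1 t' U n < 1 / 2 * energyDensityTT' 1 t' 0 (2 * n) := by
  have hn0 : (0 : ℝ) ≤ n := by linarith
  have hn2' : n < 2 := by linarith
  have h2n0 : (0 : ℝ) ≤ 2 * n := by linarith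
  have h2n2 : 2 * n < 2 := by linarith
  have h10 : (0 : ℝ) ≤ 10 := by norm_num
  have hM := polarU_cap78_tpm1o4_U10 h445 h257lo h257up
  have hC := polarU_halfFilling_cap10 h471 t'
  have ra := fermiSeaTangentRow_tPrime_neg_three_div_ten_at_ninetythree_div_fifty (U := 0) le_rfl h2n0 h2n2
  have rb := fermiSeaTangentRow_tPrime_neg_one_div_four_at_ninetythree_div_fifty (U := 0) le_rfl h2n0 h2n2
  have rc := fermiSeaTangentRow_tPrime_neg_one_div_five_at_ninetythree_div_fifty (U := 0) le_rfl h2n0 h2n2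
  rcases le_or_gt t' (-1 / 4) with hp | hp
  · -- piece `t' ∈ [-3/10, -1/4]`: far side of the anchor
    have hcap := polarU_highBand_deep (n := n) h10 hM hC (b := -1 / 4) le_rfl hp hn1 (by linarith) (by linarith)
    have hfl := objE_floor_between (s := t') h2n0 h2n2 (by norm_num : (-3 / 10 : ℝ) ≤ -1 / 4) ra rb (by linarith) (by linarith)
    exact polar_word_of_cap hU0 hU hn0 hn2' hcap hfl (by linarith) (by linarith)
  · -- piece `t' ∈ (-1/4, -1/5]`: near side of the anchor
    have hcap := polarU_highBand_shallow (n := n) h10 hM hC (a := -1 / 4) le_rfl hp.le hn1 (by linarith) (by linarith)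
    have hfl := objE_floor_between (s := t') h2n0 h2n2 (by norm_num : (-1 / 4 : ℝ) ≤ -1 / 5) rb rc (by linarith) (by linarith)
    exact polar_word_of_cap hU0 hU hn0 hn2' hcap hfl (by linarith) (by linarith)

end Summit.Ventures.CertifiedManyBodySolver.Observables

end
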